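import Mathlib.Analysis.Complex.Liouville
import Mathlib.Analysis.Calculus.MeanValue
import Mathlib.Algebra.BigOperators.Ring.Finset
import Mathlib.Algebra.Group.ForwardDiff
import HarnessLib

/-!
# Iterated finite differences of entire functions of several complex variables

For a function `g : (K → ℂ) → ℂ` of finitely many complex variables and a finite set `S` of
coordinates, the **iterated finite difference** with step `τ` in the coordinates of `S` at the
base point `c` is the inclusion–exclusion sum

  `Δ^τ_S g (c) = Σ_{T ⊆ S} (-1)^{|S ∖ T|} g (c + τ 1_T)`          (`iterDiff`)

(`1_T` the indicator vector of `T`, Mathlib's `Set.indicator ↑T 1`); it is the composition of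
the one-coordinate forward differences `fwdDiff (τ e_k)`, `k ∈ S` (`iterDiff_insert`,
`iterDiff_singleton`). If `g` is entire, we prove the **Cauchy bound**

  `|Δ^τ_S g (c)| ≤ (|τ|/R)^{|S|} · sup { |g(c')| : |c'_k - c_k| ≤ |τ| + R (k ∈ S), c'_k = c_k (k ∉ S) }`

(`norm_iterDiff_le`), by induction on `S`: the one-variable mean value inequality
(`Convex.norm_image_sub_le_of_norm_deriv_le`) and the Cauchy estimate for the first derivative on
circles of radius `R` (`Complex.norm_deriv_le_of_forall_mem_sphere_norm_le`). This is the
standard Cauchy-inequality bound for finite differences (Hörmander, Thm. 2.2.7 style); it is the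
several-variables estimate behind the bound on Möbius-inverted ("connected") Gibbs factors of
polymer expansions whose weights are defined by inclusion–exclusion over sets of interaction
terms: the truncated factor of a set `S` of couplings is the iterated difference of the (entire)
finite-volume Gibbs factor in the coupling constants, hence `O((|τ|/R)^{|S|})`. (Ueltschi 1999,
§2.3, obtains the same smallness `(βt)^m` per hopping term from the Duhamel expansion instead;
that paper is motivation, not a source, for the statements below.)

## Mathlib / tree search

Mathlib: `fwdDiff` (`Mathlib.Algebra.Group.ForwardDiff`: one-step forward differences and their
iterates `fwdDiff_iter` in a FIXED direction; no mixed differences over a set of directions and no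
analytic estimates), `Set.indicator`, `Complex.norm_deriv_le_of_forall_mem_sphere_norm_le`,
`Convex.norm_image_sub_le_of_norm_deriv_le`, `Finset.sum_powerset_insert`. Tree:
`Literature.Analysis.Complex.SCV.norm_fderiv_apply_le` (Cauchy estimates for Fréchet derivatives
on balls, `SeveralVariables`), not the polydisc/inclusion–exclusion form needed here;
`Literature.Computability.QuantumComplexity.indicatorVec` is an unrelated `ℝ`-valued indicator
(we use Mathlib's `Set.indicator`).

## References

* L. Hörmander, *An Introduction to Complex Analysis in Several Variables*, Thm. 2.2.7 (Cauchy's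
  inequalities on polydiscs). [folklore]
* D. Ueltschi, J. Stat. Phys. 95 (1999) 693, §2.3 (motivation only: smallness of polymer weights
  per interaction term). [Ueltschi1999]
-/

noncomputable section

namespace Literature.Analysis.Complex

namespace FiniteDifference

open Finset Metric

variable {K : Type*} [DecidableEq K]

/-! ### Indicator vectors (Mathlib's `Set.indicator`) -/

section Indicator

/-- The indicator vector `1_T = Set.indicator ↑T 1 ∈ ℂ^K` in coordinates. [folklore] -/
theorem indicator_coe_apply (T : Finset K) (k : K) :
    Set.indicator (↑T : Set K) (1 : K → ℂ) k = if k ∈ T then 1 else 0 := by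
  rw [Set.indicator_apply, Pi.one_apply]
  simp only [Finset.mem_coe]

/-- `1_{T ∪ {k}} = 1_T + e_k` for `k ∉ T`. [folklore] -/
theorem indicator_coe_insert {T : Finset K} {k : K} (hk : k ∉ T) :
    Set.indicator (↑(insert k T) : Set K) (1 : K → ℂ) = Set.indicator (↑T : Set K) 1 + Pi.single k 1 := by
  funext k'
  rw [Pi.add_apply, indicator_coe_apply, indicator_coe_apply]
  by_cases h : k' = k
  · subst h; simp [hk]
  · simp [h]

end Indicator

/-! ### Iterated differences -/

section Diff

/-- **The iterated finite difference** `Δ^τ_S g (c) = Σ_{T ⊆ S} (-1)^{|S∖T|} g(c + τ 1_T)` of `g`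
in the coordinates `S` with step `τ` at `c`. [folklore] -/
def iterDiff (τ : ℂ) (S : Finset K) (g : (K → ℂ) → ℂ) (c : K → ℂ) : ℂ :=
  ∑ T ∈ S.powerset, (-1) ^ (S \ T).card * g (c + τ • Set.indicator (↑T : Set K) 1)

/-- No coordinates: `Δ_∅ g = g`. [folklore] -/
@[simp] theorem iterDiff_empty (τ : ℂ) (g : (K → ℂ) → ℂ) (c : K → ℂ) : iterDiff τ ∅ g c = g c := by
  have h0 : c + τ • Set.indicator (↑(∅ : Finset K) : Set K) (1 : K → ℂ) = c := by
    funext k; simp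
  rw [iterDiff, Finset.powerset_empty, Finset.sum_singleton, h0, Finset.sdiff_self, Finset.card_empty, pow_zero, one_mul]

/-- **Peeling one coordinate**: `Δ_{S ∪ {k}} g (c) = Δ_S (fwdDiff (τ e_k) g) (c)` for `k ∉ S`,
where `fwdDiff (τ e_k) g = g(· + τ e_k) - g` is Mathlib's forward difference. [folklore] -/
theorem iterDiff_insert (τ : ℂ) {S : Finset K} {k : K} (hk : k ∉ S) (g : (K → ℂ) → ℂ) (c : K → ℂ) :
    iterDiff τ (insert k S) g c = iterDiff τ S (fwdDiff (τ • (Pi.single k 1 : K → ℂ)) g) c := by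
  unfold iterDiff fwdDiff
  rw [Finset.sum_powerset_insert hk]
  have h1 : ∀ T ∈ S.powerset, ((-1 : ℂ) ^ (insert k S \ T).card * g (c + τ • Set.indicator (↑T : Set K) 1)) =
      -((-1 : ℂ) ^ (S \ T).card * g (c + τ • Set.indicator (↑T : Set K) 1)) := by
    intro T hT
    have hkT : k ∉ T := fun h => hk (Finset.mem_powerset.1 hT h)
    rw [Finset.insert_sdiff_of_notMem _ hkT, Finset.card_insert_of_notMem (fun h => hk (Finset.mem_sdiff.1 h).1),
      pow_succ]
    ring
  have h2 : ∀ T ∈ S.powerset,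
      ((-1 : ℂ) ^ (insert k S \ insert k T).card * g (c + τ • Set.indicator (↑(insert k T) : Set K) 1)) =
      (-1 : ℂ) ^ (S \ T).card * g (c + τ • Set.indicator (↑T : Set K) 1 + τ • (Pi.single k 1 : K → ℂ)) := by
    intro T hT
    have hkT : k ∉ T := fun h => hk (Finset.mem_powerset.1 hT h)
    rw [Finset.insert_sdiff_insert, Finset.sdiff_insert_of_notMem hk, indicator_coe_insert hkT, smul_add, add_assoc]
  rw [Finset.sum_congr rfl h1, Finset.sum_congr rfl h2, Finset.sum_neg_distrib, ← sub_eq_neg_add,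
    ← Finset.sum_sub_distrib]
  refine Finset.sum_congr rfl fun T _ => ?_
  ring

/-- One coordinate: `Δ_{{k}} g = fwdDiff (τ e_k) g` (Mathlib's forward difference). [folklore] -/
theorem iterDiff_singleton (τ : ℂ) (k : K) (g : (K → ℂ) → ℂ) (c : K → ℂ) :
    iterDiff τ {k} g c = fwdDiff (τ • (Pi.single k 1 : K → ℂ)) g c := by
  rw [show ({k} : Finset K) = insert k ∅ from rfl, iterDiff_insert τ (Finset.notMem_empty k), iterDiff_empty]

/-- The anisotropic polydisc condition: `c'` is within `ρ` of `c` in the coordinates of `S` and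
agrees with `c` elsewhere. [folklore] -/
def InPolydisc (S : Finset K) (c : K → ℂ) (ρ : ℝ) (c' : K → ℂ) : Prop :=
  (∀ k ∈ S, ‖c' k - c k‖ ≤ ρ) ∧ ∀ k ∉ S, c' k = c k

omit [DecidableEq K] in
/-- The centre lies in its polydisc (for `ρ ≥ 0`). [folklore] -/
theorem inPolydisc_self {S : Finset K} {c : K → ℂ} {ρ : ℝ} (hρ : 0 ≤ ρ) : InPolydisc S c ρ c :=
  ⟨fun k _ => by simp [hρ], fun _ _ => rfl⟩

/-- Moving within radius `ρ` in a new coordinate `k` from a point of the `S`-polydisc stays in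
the `S ∪ {k}`-polydisc. [folklore] -/
theorem inPolydisc_insert_of_add_single {S : Finset K} {c c' : K → ℂ} {ρ : ℝ} {k : K}
    (hk : k ∉ S) (hc' : InPolydisc S c ρ c') {z : ℂ} (hz : ‖z‖ ≤ ρ) :
    InPolydisc (insert k S) c ρ (c' + z • (Pi.single k 1 : K → ℂ)) := by
  refine ⟨fun k' hk' => ?_, fun k' hk' => ?_⟩
  · rcases Finset.mem_insert.1 hk' with rfl | hk'S
    · have h0 : c' k' = c k' := hc'.2 k' hk
      simp [h0, hz]
    · have hne : k' ≠ k := fun h => hk (h ▸ hk'S)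
      simp [Pi.single_eq_of_ne hne, hc'.1 k' hk'S]
  · have hne : k' ≠ k := fun h => hk' (h ▸ Finset.mem_insert_self k S)
    have hk'S : k' ∉ S := fun h => hk' (Finset.mem_insert_of_mem h)
    simp [Pi.single_eq_of_ne hne, hc'.2 k' hk'S]

variable [Fintype K]

/-- **One-variable step**: if `g` is entire and `|g| ≤ B` on the `(S ∪ {k})`-polydisc of radius
`|τ| + R` about `c` (`R > 0`, `k ∉ S`), then the forward difference `g(c' + τ e_k) - g(c')` is at
most `(|τ|/R) B` at every point `c'` of the `S`-polydisc (mean value inequality along the segment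
`[c', c' + τ e_k]` and Cauchy's estimate for `∂_k g` on circles of radius `R`; Hörmander
Thm. 2.2.7 style). [folklore] -/
theorem norm_fwdDiff_le_of_inPolydisc {S : Finset K} {k : K} (hk : k ∉ S) {g : (K → ℂ) → ℂ}
    (hg : Differentiable ℂ g) {c : K → ℂ} {τ : ℂ} {R B : ℝ} (hR : 0 < R)
    (hB : ∀ c', InPolydisc (insert k S) c (‖τ‖ + R) c' → ‖g c'‖ ≤ B)
    {c' : K → ℂ} (hc' : InPolydisc S c (‖τ‖ + R) c') :
    ‖fwdDiff (τ • (Pi.single k 1 : K → ℂ)) g c'‖ ≤ ‖τ‖ / R * B := by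
  -- the one-variable section
  set φ : ℂ → ℂ := fun ζ => g (c' + ζ • (Pi.single k 1 : K → ℂ)) with hφ
  have hφd : Differentiable ℂ φ := by
    rw [hφ]
    fun_prop
  -- Cauchy estimate for `φ'` on the closed disc of radius `|τ|`
  have hderiv : ∀ ζ ∈ closedBall (0 : ℂ) ‖τ‖, ‖deriv φ ζ‖ ≤ B / R := by
    intro ζ hζ
    refine Complex.norm_deriv_le_of_forall_mem_sphere_norm_le hR hφd.diffContOnCl fun z hz => ?_
    apply hB
    have hz' : ‖z‖ ≤ ‖τ‖ + R := by
      have h1 : ‖z - ζ‖ = R := by rwa [mem_sphere_iff_norm] at hz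
      have h2 : ‖ζ‖ ≤ ‖τ‖ := by rwa [mem_closedBall, dist_zero_right] at hζ
      calc ‖z‖ = ‖(z - ζ) + ζ‖ := by rw [sub_add_cancel]
        _ ≤ ‖z - ζ‖ + ‖ζ‖ := norm_add_le _ _
        _ ≤ R + ‖τ‖ := add_le_add h1.le h2
        _ = ‖τ‖ + R := add_comm _ _
    exact inPolydisc_insert_of_add_single hk hc' hz'
  have hmvt := (convex_closedBall (0 : ℂ) ‖τ‖).norm_image_sub_le_of_norm_deriv_le
    (fun ζ _ => hφd.differentiableAt) hderiv (mem_closedBall_self (norm_nonneg τ))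
    (by rw [mem_closedBall, dist_zero_right])
  have h0 : φ 0 = g c' := by simp [hφ]
  have hτ : φ τ = g (c' + τ • (Pi.single k 1 : K → ℂ)) := rfl
  rw [fwdDiff, ← hτ, ← h0]
  calc ‖φ τ - φ 0‖ ≤ B / R * ‖τ - 0‖ := hmvt
    _ = ‖τ‖ / R * B := by rw [sub_zero]; ring

/-- **Cauchy bound for iterated differences.** If `g : ℂ^K → ℂ` is entire, `R > 0`, and
`|g| ≤ B` on the anisotropic polydisc `{c' : |c'_k - c_k| ≤ |τ| + R (k ∈ S), c'_k = c_k (k ∉ S)}`,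
then `|Δ^τ_S g (c)| ≤ (|τ|/R)^{|S|} B` (Hörmander Thm. 2.2.7 style Cauchy inequalities, iterated).
[folklore] -/
theorem norm_iterDiff_le {g : (K → ℂ) → ℂ} (hg : Differentiable ℂ g) {τ : ℂ} {R : ℝ} (hR : 0 < R)
    (S : Finset K) {c : K → ℂ} {B : ℝ} (hB : ∀ c', InPolydisc S c (‖τ‖ + R) c' → ‖g c'‖ ≤ B) :
    ‖iterDiff τ S g c‖ ≤ (‖τ‖ / R) ^ S.card * B := by
  induction S using Finset.induction_on generalizing g B with
  | empty =>
    rw [iterDiff_empty, Finset.card_empty, pow_zero, one_mul]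
    exact hB c (inPolydisc_self (by positivity))
  | @insert k S hk ih =>
    rw [iterDiff_insert τ hk, Finset.card_insert_of_notMem hk, pow_succ, mul_assoc]
    have hd : Differentiable ℂ (fwdDiff (τ • (Pi.single k 1 : K → ℂ)) g) := by
      unfold fwdDiff; fun_prop
    exact ih hd fun c' hc' => norm_fwdDiff_le_of_inPolydisc hk hg hR hB hc'

/-- The special case used for polymer weights: base point `0`, and a bound `|g| ≤ B` on the whole
sup-norm ball of radius `|τ| + R` restricted to vectors supported in `S`. [folklore] -/
theorem norm_iterDiff_zero_le {g : (K → ℂ) → ℂ} (hg : Differentiable ℂ g) {τ : ℂ} {R : ℝ} (hR : 0 < R)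
    (S : Finset K) {B : ℝ}
    (hB : ∀ c' : K → ℂ, (∀ k, ‖c' k‖ ≤ ‖τ‖ + R) → (∀ k ∉ S, c' k = 0) → ‖g c'‖ ≤ B) :
    ‖iterDiff τ S g 0‖ ≤ (‖τ‖ / R) ^ S.card * B := by
  refine norm_iterDiff_le hg hR S fun c' hc' => hB c' (fun k => ?_) hc'.2
  by_cases hk : k ∈ S
  · simpa using hc'.1 k hk
  · rw [hc'.2 k hk]
    simp only [Pi.zero_apply, norm_zero]
    positivity

end Diff

end FiniteDifference

end Literature.Analysis.Complex

end
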